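import Summits.AnomalousDissipation.AnomalousDissipation.Theorems.SawtoothPulseCascadeK1LocalisedCascadeSlotPartitionStep
import Summits.AnomalousDissipation.AnomalousDissipation.Theorems.SawtoothPulseCascadeK1LocalisedCascadeSlotFibreSum

/-!
# K1loc, line `Spectral` / SeqCone — helper: SPLITTING THE TRACKED ENERGY INTO THE TWO STRIP FAMILIES WITHOUT A CROSS TERM

Helper file of the prover lane on the crux `K1LocalisedCascade` (stmt-AnomalousDissipation-19491), route
`SawtoothPulseCascade` (memo v6 §4, S-C).  At the start of a half-slot the tracked energy `‖μ(D)F‖` of the good piece `F`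
must be distributed over the two per-family inputs `‖μ(D)(X̃^σ F)‖` of `…FamilyStep`.  `…FamilySplit` does this with the
lower two-piece inequality and a cross-term bound; here the same PARTITION argument as in the un-gauging step
(`…SlotPartitionStep`) gives it with NO cross term: from the keep-form commutator bounds
`‖μ(D)(Θ^σF)‖ ≤ ‖Θ^σ·μ(D)F‖ + E_σ‖F‖` (`sqrt_tsum_symbol_sq_mul_le_of_expansion_keep`) and `|Θ⁺|² + |Θ⁻|² ≤ 1`,
  `√(‖μ(D)(Θ⁺F)‖² + ‖μ(D)(Θ⁻F)‖²) ≤ ‖μ(D)F‖ + √(E⁺² + E⁻²)·‖F‖`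
(`sqrt_add_sq_symbol_mul_le_of_partition`), i.e. the hypothesis `hsplit` of `…FamilySplit.recombine_families` with `c₀ = 0`
after replacing `I` by `‖μ(D)F‖ + √(E⁺²+E⁻²)‖F‖`.  No definitions; no statement about the stub.
[cite: Grafakos2014, Prop. 3.1.2 (5) and Prop. 3.2.7 (3)] [problem: turb]
-/

-- `Summit.<Summit>.<Problem>`: single-conjunct summit, the duplicate namespace segment is deliberate.
set_option linter.dupNamespace false

noncomputable section

namespace Summit.AnomalousDissipation.AnomalousDissipation.Theorems.SawtoothPulseCascade.K1Slot

open MeasureTheory Set Filter Topology UnitAddTorus Complex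
open scoped ComplexConjugate
open Literature.Analysis Literature.Analysis.FunctionSpaces Literature.Analysis.FluidPDE
open Literature.Analysis.FunctionSpaces.Torus
open Summit.AnomalousDissipation.AnomalousDissipation.Theorems.SawtoothPulseCascade.SpectralLeakage

variable {d : Type*} [Fintype d]

/-- **Splitting a tracked energy over a sub-partition, no cross term.**  Let `Θ⁺, Θ⁻` be continuous with
`|Θ⁺|² + |Θ⁻|² ≤ 1`, `F` have absolutely summable coefficients, `μ` be a bounded real symbol and `h = μ(D)F` the Fourier
synthesis of `μ·𝓕F`; suppose the commutator bounds `√Σ μ²|𝓕(Θ^σF)|² ≤ √∫‖Θ^σ h‖² + E_σ √∫‖F‖²` (`E_σ ≥ 0`; the keep-form expansion).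
Then `√(Σ μ²|𝓕(Θ⁺F)|² + Σ μ²|𝓕(Θ⁻F)|²) ≤ √Σ μ²|𝓕F|² + √(E⁺² + E⁻²)·√∫‖F‖²`.
[cite: Grafakos2014, Prop. 3.1.2 (5) and Prop. 3.2.7 (3)] -/
theorem sqrt_add_sq_symbol_mul_le_of_partition {F Θp Θm : UnitAddTorus d → ℂ}
    (hFs : Summable fun k => ‖mFourierCoeff F k‖) (hΘp : Continuous Θp) (hΘm : Continuous Θm)
    (hpart : ∀ x, ‖Θp x‖ ^ 2 + ‖Θm x‖ ^ 2 ≤ 1) {μ : (d → ℤ) → ℝ} {M : ℝ} (hμM : ∀ k, |μ k| ≤ M)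
    {Ep Em : ℝ} (hEp : 0 ≤ Ep) (hEm : 0 ≤ Em)
    (hcp : Real.sqrt (∑' k, μ k ^ 2 * ‖mFourierCoeff (fun x => Θp x * F x) k‖ ^ 2) ≤
      Real.sqrt (∫ x, ‖Θp x * fourierSynth (fun k => (μ k : ℂ) * mFourierCoeff F k) x‖ ^ 2) +
        Ep * Real.sqrt (∫ x, ‖F x‖ ^ 2))
    (hcm : Real.sqrt (∑' k, μ k ^ 2 * ‖mFourierCoeff (fun x => Θm x * F x) k‖ ^ 2) ≤
      Real.sqrt (∫ x, ‖Θm x * fourierSynth (fun k => (μ k : ℂ) * mFourierCoeff F k) x‖ ^ 2) +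
        Em * Real.sqrt (∫ x, ‖F x‖ ^ 2)) :
    Real.sqrt ((∑' k, μ k ^ 2 * ‖mFourierCoeff (fun x => Θp x * F x) k‖ ^ 2) +
        ∑' k, μ k ^ 2 * ‖mFourierCoeff (fun x => Θm x * F x) k‖ ^ 2) ≤
      Real.sqrt (∑' k, μ k ^ 2 * ‖mFourierCoeff F k‖ ^ 2) + Real.sqrt (Ep ^ 2 + Em ^ 2) * Real.sqrt (∫ x, ‖F x‖ ^ 2) := by
  -- the synthesis `h = μ(D)F` and its norm
  set h : UnitAddTorus d → ℂ := fourierSynth (fun k => (μ k : ℂ) * mFourierCoeff F k) with hh_def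
  have hM0 : 0 ≤ M := (abs_nonneg _).trans (hμM 0)
  have hhs : Summable fun k => ‖(μ k : ℂ) * mFourierCoeff F k‖ := by
    refine (hFs.mul_left M).of_nonneg_of_le (fun _ => norm_nonneg _) fun k => ?_
    rw [norm_mul, Complex.norm_real, Real.norm_eq_abs]
    exact mul_le_mul_of_nonneg_right (hμM k) (norm_nonneg _)
  have hh_c : Continuous h := continuous_fourierSynth hhs
  have hh_pars : ∫ x, ‖h x‖ ^ 2 = ∑' k, μ k ^ 2 * ‖mFourierCoeff F k‖ ^ 2 := by
    have hP := hasSum_sq_mFourierCoeff_of_continuous hh_c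
    rw [← hP.tsum_eq]
    exact tsum_congr fun k => by
      rw [hh_def, mFourierCoeff_fourierSynth hhs, norm_mul, Complex.norm_real, Real.norm_eq_abs, mul_pow, sq_abs]
  have hsum := integral_norm_sq_mul_add_le hΘp hΘm hh_c hpart
  rw [hh_pars] at hsum
  -- abbreviations
  set ap := Real.sqrt (∫ x, ‖Θp x * h x‖ ^ 2) with hap
  set am := Real.sqrt (∫ x, ‖Θm x * h x‖ ^ 2) with ham
  set g := Real.sqrt (∫ x, ‖F x‖ ^ 2) with hg
  set Pp := ∑' k, μ k ^ 2 * ‖mFourierCoeff (fun x => Θp x * F x) k‖ ^ 2 with hPp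
  set Pm := ∑' k, μ k ^ 2 * ‖mFourierCoeff (fun x => Θm x * F x) k‖ ^ 2 with hPm
  have hg0 : 0 ≤ g := Real.sqrt_nonneg _
  have hap0 : 0 ≤ ap := Real.sqrt_nonneg _
  have ham0 : 0 ≤ am := Real.sqrt_nonneg _
  have hPp0 : 0 ≤ Pp := tsum_nonneg fun k => by positivity
  have hPm0 : 0 ≤ Pm := tsum_nonneg fun k => by positivity
  -- `Pp ≤ (ap + Ep g)²`, `Pm ≤ (am + Em g)²`
  have h1 : Pp ≤ (ap + Ep * g) ^ 2 := by
    calc Pp = (Real.sqrt Pp) ^ 2 := (Real.sq_sqrt hPp0).symm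
      _ ≤ (ap + Ep * g) ^ 2 := pow_le_pow_left₀ (Real.sqrt_nonneg _) hcp 2
  have h2 : Pm ≤ (am + Em * g) ^ 2 := by
    calc Pm = (Real.sqrt Pm) ^ 2 := (Real.sq_sqrt hPm0).symm
      _ ≤ (am + Em * g) ^ 2 := pow_le_pow_left₀ (Real.sqrt_nonneg _) hcm 2
  -- Minkowski in `ℝ²` and the partition
  have hM2 := add_sq_add_add_sq_le hap0 (mul_nonneg hEp hg0) ham0 (mul_nonneg hEm hg0)
  have hEg : Real.sqrt ((Ep * g) ^ 2 + (Em * g) ^ 2) = Real.sqrt (Ep ^ 2 + Em ^ 2) * g := by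
    rw [show (Ep * g) ^ 2 + (Em * g) ^ 2 = (Ep ^ 2 + Em ^ 2) * g ^ 2 by ring,
      Real.sqrt_mul' _ (sq_nonneg g), Real.sqrt_sq hg0]
  rw [hEg] at hM2
  have hap2 : ap ^ 2 = ∫ x, ‖Θp x * h x‖ ^ 2 := Real.sq_sqrt (integral_nonneg fun x => by positivity)
  have ham2 : am ^ 2 = ∫ x, ‖Θm x * h x‖ ^ 2 := Real.sq_sqrt (integral_nonneg fun x => by positivity)
  have hprin : Real.sqrt (ap ^ 2 + am ^ 2) ≤ Real.sqrt (∑' k, μ k ^ 2 * ‖mFourierCoeff F k‖ ^ 2) := by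
    rw [hap2, ham2]; exact Real.sqrt_le_sqrt hsum
  have hS0 : 0 ≤ Real.sqrt (Ep ^ 2 + Em ^ 2) * g := mul_nonneg (Real.sqrt_nonneg _) hg0
  have htot : Pp + Pm ≤ (Real.sqrt (∑' k, μ k ^ 2 * ‖mFourierCoeff F k‖ ^ 2) + Real.sqrt (Ep ^ 2 + Em ^ 2) * g) ^ 2 := by
    have hM3 : (Real.sqrt (ap ^ 2 + am ^ 2) + Real.sqrt (Ep ^ 2 + Em ^ 2) * g) ^ 2 ≤
        (Real.sqrt (∑' k, μ k ^ 2 * ‖mFourierCoeff F k‖ ^ 2) + Real.sqrt (Ep ^ 2 + Em ^ 2) * g) ^ 2 :=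
      pow_le_pow_left₀ (add_nonneg (Real.sqrt_nonneg _) hS0) (add_le_add hprin le_rfl) 2
    linarith [h1, h2, hM2, hM3]
  calc Real.sqrt (Pp + Pm)
      ≤ Real.sqrt ((Real.sqrt (∑' k, μ k ^ 2 * ‖mFourierCoeff F k‖ ^ 2) + Real.sqrt (Ep ^ 2 + Em ^ 2) * g) ^ 2) :=
        Real.sqrt_le_sqrt htot
    _ = _ := Real.sqrt_sq (add_nonneg (Real.sqrt_nonneg _) hS0)

end Summit.AnomalousDissipation.AnomalousDissipation.Theorems.SawtoothPulseCascade.K1Slot
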